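import Mathlib
import Summits.Ventures.PercRepro2.Defs
import Summits.Ventures.PercRepro2.Independence
import Summits.Ventures.PercRepro2.Harris
import Summits.Ventures.PercRepro2.Graph
import Summits.Ventures.PercRepro2.Exploration
import Summits.Ventures.PercRepro2.Events
import Summits.Ventures.PercRepro2.FourFunctions
import Summits.Ventures.PercRepro2.Induced
import Summits.Ventures.PercRepro2.Frontier
import Summits.Ventures.PercRepro2.ObsIndependence
import Summits.Ventures.PercRepro2.BHK
import Summits.Ventures.PercRepro2.BHKEvents
import Summits.Ventures.PercRepro2.OrderPreservation
import Summits.Ventures.PercRepro2.OrderPreservationDual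
import Summits.Ventures.PercRepro2.VdBKahn
import Summits.Ventures.PercRepro2.BHKAvoid
import Summits.Ventures.PercRepro2.R2PrimeThreeReduction
import Summits.Ventures.PercRepro2.YBridge
import Summits.Ventures.PercRepro2.Yu1Functionals
import Summits.Ventures.PercRepro2.Yu1Events
import Summits.Ventures.PercRepro2.Yu1
import Summits.Ventures.PercRepro2.LBSplit
import Summits.Ventures.PercRepro2.YDelta
import Summits.Ventures.PercRepro2.YDeltaTools
import Summits.Ventures.PercRepro2.SD
import Summits.Ventures.PercRepro2.Threshold
import Summits.Ventures.PercRepro2.Lambda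
import Summits.Ventures.PercRepro2.LambdaTau
import Summits.Ventures.PercRepro2.LambdaSlack
import Summits.Ventures.PercRepro2.HF2
import Summits.Ventures.PercRepro2.Yu2
import Summits.Ventures.PercRepro2.N0
import Summits.Ventures.PercRepro2.Y
import Summits.Ventures.PercRepro2.ZDelta
import Summits.Ventures.PercRepro2.ZExpand
import Summits.Ventures.PercRepro2.RGapShare

import Summits.Ventures.PercRepro2.ZhTwoCopy

/-!
# The two-copy forms of L2 and of the crux (ZΔ) (blind cell PercRepro2, p1 g5; `proofs/P1-L1TWOCOPY.md` §5)

With `T₂ = twoCopyT` and the (C1)-slack `Zh2c = D_o · Δ_T − P(PD) · [P(T, o ∈ C₁, b ∈ C₂) − T₂] ≤ Z_h`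
(`Zh2c_le_Zh`, Harris in `G ∖ U`), the location cut `Z = Z_0 + Z_h + Z_l` (`Z_location_cut`) gives
the two STRICTLY STRONGER census-clean rows (0 / 452 exact labelled instances incl. the canonical
NEG-32 witness and its perturbation family over all root orderings):

* `Z0Zh2cNonneg := 0 ≤ Z_0 + Zh2c` (the two-copy L2) with `Z0ZhNonneg_of_Z0Zh2c : Z0Zh2cNonneg → Z0ZhNonneg`;
* `ZTwoCopy := 0 ≤ Z_0 + Zh2c + Z_l` (the two-copy crux) with `ZDelta_of_ZTwoCopy : ZTwoCopy → ZDelta`.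
* `ZhTwoCopy_iff : ZhTwoCopy ↔ 0 ≤ Zh2c`.
-/

namespace Summit.Ventures.PercRepro2

open UnionCluster Yu1

section TwoCopyCrux

variable {V : Type*} {E : Type*} [Fintype E] [DecidableEq E] [Fintype V] [DecidableEq V]
  {R : Type*} [Field R] [LinearOrder R] [IsStrictOrderedRing R]

/-- The (C1)-slack `Zh2c = D_o · Δ_T − P(PD) · [P(T, o ∈ C₁, b ∈ C₂) − T₂]` (`Z_h` with the T-world
"o, b both light" term replaced by its two-copy product). -/
noncomputable def Zh2c (p : E → R) (ends : E → Sym2 V) (o a₁ a₂ a₃ b : V) : R :=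
  (prob p (PDEvent ends a₁ a₂ a₃ ∩ connEvent ends a₁ o) +
      prob p (PDEvent ends a₁ a₂ a₃ ∩ connEvent ends a₂ o)) * deltaT p ends a₁ a₂ a₃ b -
    prob p (PDEvent ends a₁ a₂ a₃) *
      (prob p (TEvent ends a₁ a₂ a₃ ∩ connEvent ends a₁ o ∩ connEvent ends a₂ b) -
        twoCopyT p ends o a₁ a₂ a₃ b)

omit [DecidableEq V] in
/-- `Zh2c ≤ Z_h` (Harris in `G ∖ U`: `T₂ ≤ P(T, o ∈ C₁, b ∈ C₁)`). -/
lemma Zh2c_le_Zh (p : E → R) (hp : IsProbVec p) (ends : E → Sym2 V) (o a₁ a₂ a₃ b : V) :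
    Zh2c p ends o a₁ a₂ a₃ b ≤ Zh p ends o a₁ a₂ a₃ b := by
  unfold Zh2c Zh
  have ht := twoCopyT_le p hp ends o a₁ a₂ a₃ b
  have hD : 0 ≤ prob p (PDEvent ends a₁ a₂ a₃) := prob_nonneg hp _
  nlinarith [mul_le_mul_of_nonneg_left ht hD]

omit [Fintype V] [DecidableEq V] in
/-- `(C1)` is `0 ≤ Zh2c`. -/
lemma ZhTwoCopy_iff (p : E → R) (ends : E → Sym2 V) (o a₁ a₂ a₃ b : V) :
    ZhTwoCopy p ends o a₁ a₂ a₃ b ↔ 0 ≤ Zh2c p ends o a₁ a₂ a₃ b := by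
  unfold ZhTwoCopy Zh2c
  constructor <;> intro h <;> linarith

/-- **The two-copy L2**: `0 ≤ Z_0 + Zh2c` (census-clean, strictly stronger than `Z0ZhNonneg`).  OPEN. -/
def Z0Zh2cNonneg (p : E → R) (ends : E → Sym2 V) (o a₁ a₂ a₃ b : V) : Prop :=
  0 ≤ Z0 p ends o a₁ a₂ a₃ b + Zh2c p ends o a₁ a₂ a₃ b

/-- **The two-copy crux**: `0 ≤ Z_0 + Zh2c + Z_l` — `(ZΔ)` with the T-world "o, b both light" term
replaced by `P(T, o ∈ S¹, b ∈ S²)` (census-clean 0 / 452, strictly stronger than `ZDelta`).  OPEN. -/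
def ZTwoCopy (p : E → R) (ends : E → Sym2 V) (o a₁ a₂ a₃ b : V) : Prop :=
  0 ≤ Z0 p ends o a₁ a₂ a₃ b + Zh2c p ends o a₁ a₂ a₃ b + Zl p ends o a₁ a₂ a₃ b

omit [DecidableEq V] in
/-- The two-copy L2 implies L2. -/
theorem Z0ZhNonneg_of_Z0Zh2c (p : E → R) (hp : IsProbVec p) (ends : E → Sym2 V)
    {o a₁ a₂ a₃ b : V} (h : Z0Zh2cNonneg p ends o a₁ a₂ a₃ b) :
    Z0ZhNonneg p ends o a₁ a₂ a₃ b := by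
  unfold Z0ZhNonneg
  unfold Z0Zh2cNonneg at h
  linarith [Zh2c_le_Zh p hp ends o a₁ a₂ a₃ b]

omit [DecidableEq V] in
/-- **The crux from its two-copy form**: `ZTwoCopy → ZDelta`. -/
theorem ZDelta_of_ZTwoCopy (p : E → R) (hp : IsProbVec p) (ends : E → Sym2 V)
    {o a₁ a₂ a₃ b : V} (h : ZTwoCopy p ends o a₁ a₂ a₃ b) : ZDelta p ends o a₁ a₂ a₃ b := by
  unfold ZDelta
  have e := Z_location_cut p ends o a₁ a₂ a₃ b
  unfold ZTwoCopy at h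
  linarith [Zh2c_le_Zh p hp ends o a₁ a₂ a₃ b]

end TwoCopyCrux

end Summit.Ventures.PercRepro2
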